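import Mathlib
import Summits.ValiantsHypothesis.ValiantsHypothesis.Theorems.KPlusLogSqLawWeakLiftingTowerGraftFoldLawRankTwo
import Summits.ValiantsHypothesis.ValiantsHypothesis.Theorems.KPlusLogSqLawWeakLiftingTowerGraftSizeMono

/-!
# Tower graft line — THE EVENT BUDGET OF A RANK-TWO INDEFINITE GRAFT, in S5's own currency (one class budget, the base size)

Mechanism file for the line `Cruxes/WeakLifting/Lines/tower_graft.lean` (crux `WeakLifting` = stmt-ValiantsHypothesis-19561), memo §3 T3 /
§18; packaging of p709692 (`…FoldLawAxisPair`) and p710589 (`…FoldLawRankTwo`) with size monotonicity p658112 (`…SizeMono`).  NO stub is claimed.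

S5's hypothesis for a graft on size-`N` pencils with support `d` is ONE class budget `PosRootLawOn N K B d` (the base size).  The fold-law files
state their bounds at the natural sizes of the event determinants (`N`, `N − 1`, `N − 2`); size monotonicity (`sizeMono`: a bound at a larger
size bounds every smaller size, by the padding `S ⊕ X^{d₀}·1`) converts them to the base budget:

* `card_posRoots_foldDisc_le_base` — `Z₊(E₁² − 4E₀E₂) ≤ B + B` under `PosRootLawOn (m+2) K B d` (axis pair `Eᵢᵢ − Eⱼⱼ`, size `m+2`);
* `card_posRoots_pairMinor_le_base` — `Z₊(ε) ≤ B` under the same budget;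
* ★ `eventBudget_axisPair` — **THE EVENT BUDGET**: `Z₊(E₀) + Z₊(ε) + Z₊(E₁² − 4E₀E₂) ≤ 4·B` under `PosRootLawOn (m+2) K B d` — every event of the
  memo's §1 taxonomy ((E0) base roots, (Er) escape to `T = ∞`, (Ed) folds) for the rank-two indefinite axis-pair graft is paid by S5's own class
  budget with the constant `4` and NO additive term; what S5 would still need for this graft is exactly the near-axis accounting of the
  intersections between events (T1/T2) — the phantoms, which no instance-level event count pays (NO-GO ledger, p710783 & successors);
* `card_posRoots_foldDisc_congr_le_base` — the fold term for every congruent far letter `R(Eᵢᵢ − Eⱼⱼ)Rᵀ` (all signature-(1,1) rank-two letters)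
  under the base budget.

HONEST FRAMING: bookkeeping over landed theorems; nothing on S4/S4b/S5/S5ᴸ, TowerB, `WeakLifting`, Conjecture B, `MatrixDescartes` (18050) or
`VP ≠ VNP`.  Def-free.  Seat: prover val-sym-lift-p2 g21, `--supports stmt-ValiantsHypothesis-19561`.
-/

-- `Summit.ValiantsHypothesis.ValiantsHypothesis.…` repeats a component by the D-0017 layout
-- (single-conjunct summit), which the `dupNamespace` linter flags; the name is mandated.
set_option linter.dupNamespace false

namespace Summit.ValiantsHypothesis.ValiantsHypothesis.Theorems.KPlusLogSqLaw.TowerGraft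

open Polynomial Matrix
open scoped BigOperators Polynomial
open Summit.ValiantsHypothesis.ValiantsHypothesis.Theorems.LacunarySymmetroidMatrixDescartes (PosRootLawOn)

section EventBudget

/-- the fold term under the BASE budget (size `m+2`). [this work] -/
theorem card_posRoots_foldDisc_le_base {m K B : ℕ} (d : Fin K → ℕ) (hB : PosRootLawOn (m + 2) K B d)
    (S : Fin K → Matrix (Fin (m + 2)) (Fin (m + 2)) ℝ) (hS : ∀ l, (S l).IsSymm) {i j : Fin (m + 2)} (hij : i ≠ j) :
    ((((∑ l, (X : ℝ[X]) ^ d l • (S l).map C).adjugate i i - (∑ l, (X : ℝ[X]) ^ d l • (S l).map C).adjugate j j) ^ 2 -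
        4 * (∑ l, (X : ℝ[X]) ^ d l • (S l).map C).det *
          (-(((∑ l, (X : ℝ[X]) ^ d l • (S l).map C).updateRow i (Pi.single i 1)).updateRow j
            (Pi.single j 1)).det)).roots.toFinset.filter (fun t => 0 < t)).card ≤ B + B :=
  card_posRoots_foldDisc_le d (sizeMono (m + 1) (m + 2) K B d (by omega) hB) S hS hij

/-- the (Er) term under the BASE budget. [this work] -/
theorem card_posRoots_pairMinor_le_base {m K B : ℕ} (d : Fin K → ℕ) (hB : PosRootLawOn (m + 2) K B d)
    (S : Fin K → Matrix (Fin (m + 2)) (Fin (m + 2)) ℝ) (hS : ∀ l, (S l).IsSymm) {i j : Fin (m + 2)} (hij : i ≠ j) :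
    (((((∑ l, (X : ℝ[X]) ^ d l • (S l).map C).updateRow i (Pi.single i 1)).updateRow j
        (Pi.single j 1)).det).roots.toFinset.filter (fun t => 0 < t)).card ≤ B :=
  card_posRoots_pairMinor_le d (sizeMono m (m + 2) K B d (by omega) hB) S hS hij

/-- **THE EVENT BUDGET OF THE RANK-TWO INDEFINITE AXIS-PAIR GRAFT** (S5's own currency): base roots + escapes + folds `≤ 4B` under the ONE
class budget `PosRootLawOn (m+2) K B d` of the base size. [this work] -/
theorem eventBudget_axisPair {m K B : ℕ} (d : Fin K → ℕ) (hB : PosRootLawOn (m + 2) K B d)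
    (S : Fin K → Matrix (Fin (m + 2)) (Fin (m + 2)) ℝ) (hS : ∀ l, (S l).IsSymm) {i j : Fin (m + 2)} (hij : i ≠ j) :
    ((∑ l, (X : ℝ[X]) ^ d l • (S l).map C).det.roots.toFinset.filter (fun t => 0 < t)).card +
      (((((∑ l, (X : ℝ[X]) ^ d l • (S l).map C).updateRow i (Pi.single i 1)).updateRow j
        (Pi.single j 1)).det).roots.toFinset.filter (fun t => 0 < t)).card +
      ((((∑ l, (X : ℝ[X]) ^ d l • (S l).map C).adjugate i i - (∑ l, (X : ℝ[X]) ^ d l • (S l).map C).adjugate j j) ^ 2 -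
        4 * (∑ l, (X : ℝ[X]) ^ d l • (S l).map C).det *
          (-(((∑ l, (X : ℝ[X]) ^ d l • (S l).map C).updateRow i (Pi.single i 1)).updateRow j
            (Pi.single j 1)).det)).roots.toFinset.filter (fun t => 0 < t)).card ≤ 4 * B := by
  have h0 := hB S hS
  have h1 := card_posRoots_pairMinor_le_base d hB S hS hij
  have h2 := card_posRoots_foldDisc_le_base d hB S hS hij
  omega

/-- the fold term for EVERY far letter congruent to the axis pair, under the BASE budget. [this work] -/
theorem card_posRoots_foldDisc_congr_le_base {m K B : ℕ} (d : Fin K → ℕ) (hB : PosRootLawOn (m + 2) K B d)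
    (S : Fin K → Matrix (Fin (m + 2)) (Fin (m + 2)) ℝ) (hS : ∀ l, (S l).IsSymm) {i j : Fin (m + 2)} (hij : i ≠ j)
    (R : Matrix (Fin (m + 2)) (Fin (m + 2)) ℝ) (hR : R.det ≠ 0) :
    let Q : ℝ[X][X] := ((∑ l, (X : ℝ[X]) ^ d l • (S l).map C).map (C : ℝ[X] →+* ℝ[X][X]) +
      (X : ℝ[X][X]) • (R * (Matrix.single i i (1 : ℝ) - Matrix.single j j (1 : ℝ)) * Rᵀ).map
        ((C : ℝ[X] →+* ℝ[X][X]).comp (C : ℝ →+* ℝ[X]))).det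
    ((Q.coeff 1 ^ 2 - 4 * Q.coeff 0 * Q.coeff 2).roots.toFinset.filter (fun t => 0 < t)).card ≤ B + B :=
  card_posRoots_foldDisc_congr_le d (sizeMono (m + 1) (m + 2) K B d (by omega) hB) S hS hij R hR

end EventBudget

end Summit.ValiantsHypothesis.ValiantsHypothesis.Theorems.KPlusLogSqLaw.TowerGraft
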